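import Summits.CriticalPhenomena.CardyFormulaZ2.Theorems.CardySelfDualSegmentSegmentClosedStubGateTB
import Summits.CriticalPhenomena.CardyFormulaZ2.Theorems.CardySelfDualSegmentSegmentClosedStubGateLR
import Summits.CriticalPhenomena.CardyFormulaZ2.Theorems.CardySelfDualSegmentSegmentClosedShearedBoxGeometry
import HarnessLib

/-!
# Confinement by forced gates: tall and sheared test boxes (helper for crux `SegmentClosed`, stmt-CriticalPhenomena-5473)

Route `CardySelfDualSegment` of `CriticalPhenomena/CardyFormulaZ2`, line `Sketch`, lead's stub
`stub_confinement`, tests 1 and 2. For the sheared wide box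
`R' = (rectQuad 0 A 0 1).map (shearHomeomorph β)` (`β ∈ ℍ`; the parallelogram with bottom side
`[0, A]` and top side `β + [0, A]`):

* (tall) if `2 im β - |re β| > A` then every crude bottom-to-top crossing of `R'` at a small mesh
  contains a bottom-to-top crossing of an axis-parallel lattice box twice as wide as tall
  (`stub_gateTB` with the slab `2δ ≤ im ≤ im β - 2δ`);
* (sheared) if `re β > A + im β / 2` (resp. `< -(A + im β / 2)`) then it contains a left-to-right
  crossing of an axis-parallel lattice box half as wide as tall (`stub_gateLR` with the vertical
  slab between the two sides; the crude event is symmetric in its arcs, `embDomainCrossing_comm`).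

Under the uniform box-crossing hypothesis at aspect ratio `1/2` such box crossings have
`M_t`-probability `≤ 1 - c`, so if the crude crossing probabilities of `R'` tend to some
`p > 1 - c` then `2 im β - |re β| ≤ A` (`two_mul_im_sub_abs_re_le_of_gateTB`) and
`|re β| ≤ A + im β / 2` (`abs_re_le_of_gateLR`). Also the a.e.-inclusion tool
`cornerPercolation_real_le_of_edgeSet`.
-/

noncomputable section

open Set Filter Metric MeasureTheory Complex
open scoped Topology
open Literature.Probability.RandomPlanarGeometry Literature.Probability.Percolation
open Literature.Probability.LatticeModels Literature.Barriers.CriticalPhenomena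

namespace Summit.CriticalPhenomena.CardyFormulaZ2.Cruxes.SegmentClosed.Sketch

/-- **Monotonicity along nearest-neighbour configurations.** `M_t` is carried by configurations
of lattice edges, so an inclusion of events valid for such configurations gives an inequality of
`M_t`-probabilities. -/
theorem cornerPercolation_real_le_of_edgeSet (t : unitInterval) {E F : Set (BondConfig (Site 2))}
    (h : ∀ ω : BondConfig (Site 2), ω ⊆ (zdGraph 2).edgeSet → ω ∈ E → ω ∈ F) :
    (cornerPercolation t).real E ≤ (cornerPercolation t).real F := by
  simp only [measureReal_def]
  refine ENNReal.toReal_mono (measure_ne_top _ _) (measure_mono_ae ?_)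
  filter_upwards [cornerPercolation_subset_edgeSet t] with ω hω hE
  exact h ω hω hE

/-- **Tall sheared boxes are not crossed with probability near one.** Let `β ∈ ℍ`, `A > 0` and
suppose the bottom-to-top crossings of the lattice boxes `w + [0, n] × [0, n/2]`, `n ≥ n₀`, all
have `M_t`-probability `≤ 1 - c`. If the crude `M_t`-crossing probabilities of the sheared box
`φ_β((0,A)×(0,1))` tend (as the mesh `δ → 0⁺`) to some `p > 1 - c`, then `2 im β - |re β| ≤ A`.
Indeed otherwise, for small `δ`, `stub_gateTB` (slab `2δ ≤ im ≤ im β - 2δ`, whose trace on the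
parallelogram has `re ∈ [min 0 (re β), max 0 (re β) + A]`) puts the crude crossing inside such a
box crossing with `n = ⌈(A + |re β|)/δ⌉₊`. -/
theorem two_mul_im_sub_abs_re_le_of_gateTB (t : unitInterval) {β : ℂ} (hβ : 0 < β.im) {A c p : ℝ} (hA : 0 < A) {n₀ : ℕ} (hbox : ∀ n : ℕ, n₀ ≤ n → ∀ w : ℂ, (cornerPercolation t).real (embTBCrossing (fun v => squareLatticeEmbedding.z v - w) n ((1 / 2 : ℝ) * n)) ≤ 1 - c) (hp : 1 - c < p) (hlim : Tendsto (cornerCrossingProb t ((rectQuad 0 A 0 1 hA one_pos).map (shearHomeomorph β hβ.ne'))) (𝓝[>] 0) (𝓝 p)) : 2 * β.im - |β.re| ≤ A := by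
  by_contra H
  rw [not_le] at H
  set R' := (rectQuad 0 A 0 1 hA one_pos).map (shearHomeomorph β hβ.ne') with hR'
  -- the mesh threshold
  set ε₀ : ℝ := 2 * β.im - |β.re| - A with hε₀
  have hε₀pos : 0 < ε₀ := by rw [hε₀]; linarith
  have hAr : 0 < A + |β.re| := by positivity
  set δ₀ : ℝ := min (ε₀ / 17) ((A + |β.re|) / (n₀ + 1)) with hδ₀
  have hδ₀pos : 0 < δ₀ := lt_min (by positivity) (by positivity)
  -- for `0 < δ ≤ δ₀` the crude crossing probability is at most `1 - c`
  have hbound : ∀ δ : ℝ, 0 < δ → δ ≤ δ₀ → cornerCrossingProb t R' δ ≤ 1 - c := by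
    intro δ hδ hδle
    have hδ1 : δ ≤ ε₀ / 17 := hδle.trans (min_le_left _ _)
    have hδ2 : δ ≤ (A + |β.re|) / (n₀ + 1) := hδle.trans (min_le_right _ _)
    set n : ℕ := ⌈(A + |β.re|) / δ⌉₊ with hn
    have hnge : (A + |β.re|) / δ ≤ n := Nat.le_ceil _
    have hnlt : (n : ℝ) < (A + |β.re|) / δ + 1 := Nat.ceil_lt_add_one (by positivity)
    have hn₀ : n₀ ≤ n := by
      have h1 : ((n₀ : ℝ) + 1) * δ ≤ A + |β.re| := by
        rwa [le_div_iff₀ (by positivity : (0 : ℝ) < n₀ + 1), mul_comm] at hδ2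
      have h2 : (n₀ : ℝ) + 1 ≤ (A + |β.re|) / δ := by
        rw [le_div_iff₀ hδ]; exact h1
      have h3 : (n₀ : ℝ) < n := by linarith
      exact_mod_cast h3.le
    -- the forced gate
    obtain ⟨w, hw⟩ := stub_gateTB R'.carrier (R'.arc 0) (R'.arc 2) (δ := δ)
      (x₁ := min 0 β.re) (x₂ := max 0 β.re + A) (y₁ := 2 * δ) (y₂ := β.im - 2 * δ)
      (a := n) (b := (1 / 2 : ℝ) * n) hδ
      (fun q _ hq => (bounds_of_infDist_arc_zero_le hβ hA one_pos hq).1)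
      (fun q _ hq => by
        have := (bounds_of_infDist_arc_two_le hβ hA one_pos hq).1
        linarith)
      (fun q hq _ _ => by
        rw [hR', mem_shearedBox_carrier hβ hA one_pos] at hq
        obtain ⟨h1, h2, h3, h4⟩ := hq
        have hs : 0 < q.im / β.im ∧ q.im / β.im < 1 := by
          refine ⟨div_pos h1 hβ, ?_⟩
          rw [div_lt_one hβ]; linarith
        have e : β.re * q.im / β.im = β.re * (q.im / β.im) := by ring
        rw [e] at h3 h4
        constructor
        · rcases le_or_gt 0 β.re with hr | hr
          · rw [min_eq_left hr]
            nlinarith [mul_nonneg hr hs.1.le]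
          · rw [min_eq_right hr.le]
            nlinarith [mul_lt_mul_of_neg_left hs.2 hr]
        · rcases le_or_gt 0 β.re with hr | hr
          · rw [max_eq_right hr]
            nlinarith [mul_le_mul_of_nonneg_left hs.2.le hr]
          · rw [max_eq_left hr.le]
            nlinarith [mul_neg_of_neg_of_pos hr hs.1])
      (by positivity)
      (by
        have e : (β.im - 2 * δ - 2 * δ) / δ - 4 = β.im / δ - 8 := by
          field_simp; ring
        rw [e, le_sub_iff_add_le, le_div_iff₀ hδ]
        have : (n : ℝ) * δ < A + |β.re| + δ := by
          have := mul_lt_mul_of_pos_right hnlt hδ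
          rwa [add_mul, div_mul_cancel₀ _ hδ.ne', one_mul] at this
        nlinarith)
      (by
        have e : max 0 β.re + A - min 0 β.re = A + |β.re| := by
          rcases le_or_gt 0 β.re with hr | hr
          · rw [max_eq_right hr, min_eq_left hr, abs_of_nonneg hr]; ring
          · rw [max_eq_left hr.le, min_eq_right hr.le, abs_of_neg hr]; ring
        rw [e]; exact hnge)
    calc cornerCrossingProb t R' δ
        = (cornerPercolation t).real
            (embDomainCrossing squareLatticeEmbedding.z R'.carrier δ (R'.arc 0) (R'.arc 2)) :=
          cornerCrossingProb_eq t R' δ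
      _ ≤ (cornerPercolation t).real
            (embTBCrossing (fun v => squareLatticeEmbedding.z v - w) n ((1 / 2 : ℝ) * n)) :=
          cornerPercolation_real_le_of_edgeSet t hw
      _ ≤ 1 - c := hbox n hn₀ w
  -- pass to the limit
  have hev : ∀ᶠ δ in 𝓝[>] (0 : ℝ), cornerCrossingProb t R' δ ≤ 1 - c := by
    filter_upwards [Ioc_mem_nhdsGT hδ₀pos] with δ hδ
    exact hbound δ hδ.1 hδ.2
  have hle : p ≤ 1 - c := le_of_tendsto hlim hev
  linarith


/-- The crude crossing event is symmetric in its two target arcs (open connections are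
symmetric). -/
theorem embDomainCrossing_comm {V : Type*} (z : V → ℂ) (Ω : Set ℂ) (δ : ℝ) (A B : Set ℂ) :
    embDomainCrossing z Ω δ A B = embDomainCrossing z Ω δ B A := by
  ext ω
  simp only [mem_embDomainCrossing_iff]
  constructor
  · rintro ⟨u, hu, v, hv, h⟩
    exact ⟨v, hv, u, hu, by rwa [openConnIn_comm]⟩
  · rintro ⟨u, hu, v, hv, h⟩
    exact ⟨v, hv, u, hu, by rwa [openConnIn_comm]⟩

/-- **Right-sheared boxes are not crossed with probability near one.** Let `β ∈ ℍ`, `A > 0`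
and suppose the left-to-right crossings of the lattice boxes `w + [0, n/2] × [0, n]`, `n ≥ n₀`,
all have `M_t`-probability `≤ 1 - c`. If the crude `M_t`-crossing probabilities of the sheared
box `φ_β((0,A)×(0,1))` tend to some `p > 1 - c` as the mesh `δ → 0⁺`, then
`re β ≤ A + im β / 2`. -/
theorem re_le_of_gateLR (t : unitInterval) {β : ℂ} (hβ : 0 < β.im) {A c p : ℝ} (hA : 0 < A)
    {n₀ : ℕ} (hbox : ∀ n : ℕ, n₀ ≤ n → ∀ w : ℂ, (cornerPercolation t).real
      (embRectCrossing (fun v => squareLatticeEmbedding.z v - w) ((1 / 2 : ℝ) * n) n) ≤ 1 - c)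
    (hp : 1 - c < p)
    (hlim : Tendsto (cornerCrossingProb t ((rectQuad 0 A 0 1 hA one_pos).map
      (shearHomeomorph β hβ.ne'))) (𝓝[>] 0) (𝓝 p)) :
    β.re ≤ A + β.im / 2 := by
  by_contra H
  rw [not_le] at H
  set R' := (rectQuad 0 A 0 1 hA one_pos).map (shearHomeomorph β hβ.ne') with hR'
  set ε₀ : ℝ := β.re - A - β.im / 2 with hε₀
  have hε₀pos : 0 < ε₀ := by rw [hε₀]; linarith
  set δ₀ : ℝ := 2 * ε₀ / (n₀ + 17) with hδ₀
  have hδ₀pos : 0 < δ₀ := by positivity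
  have hbound : ∀ δ : ℝ, 0 < δ → δ ≤ δ₀ → cornerCrossingProb t R' δ ≤ 1 - c := by
    intro δ hδ hδle
    have hδ1 : δ * ((n₀ : ℝ) + 17) ≤ 2 * ε₀ := by
      rwa [hδ₀, le_div_iff₀ (by positivity : (0 : ℝ) < n₀ + 17)] at hδle
    set n : ℕ := max n₀ ⌈β.im / δ⌉₊ with hn
    have hn₀ : n₀ ≤ n := le_max_left _ _
    have hnge : β.im / δ ≤ n := (Nat.le_ceil _).trans (by exact_mod_cast le_max_right _ _)
    have hnle : (n : ℝ) ≤ n₀ + (β.im / δ + 1) := by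
      have h1 : ((⌈β.im / δ⌉₊ : ℕ) : ℝ) < β.im / δ + 1 := Nat.ceil_lt_add_one (by positivity)
      have h2 : (n : ℝ) ≤ max (n₀ : ℝ) ((⌈β.im / δ⌉₊ : ℕ) : ℝ) := by
        rw [hn]; push_cast [Nat.cast_max]; exact le_rfl
      have h3 : max (n₀ : ℝ) ((⌈β.im / δ⌉₊ : ℕ) : ℝ) ≤ n₀ + (β.im / δ + 1) :=
        max_le (by linarith [div_nonneg hβ.le hδ.le]) (by linarith [h1, (Nat.cast_nonneg n₀ : (0:ℝ) ≤ n₀)])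
      linarith
    obtain ⟨w, hw⟩ := stub_gateLR R'.carrier (R'.arc 0) (R'.arc 2) (δ := δ)
      (x₁ := A + 2 * δ) (x₂ := β.re - 2 * δ) (y₁ := 0) (y₂ := β.im)
      (a := (1 / 2 : ℝ) * n) (b := n) hδ
      (fun q _ hq => by
        have := (bounds_of_infDist_arc_zero_le hβ hA one_pos hq).2.2
        linarith)
      (fun q _ hq => by
        have := (bounds_of_infDist_arc_two_le hβ hA one_pos hq).2.1
        linarith)
      (fun q hq _ _ => by
        rw [hR', mem_shearedBox_carrier hβ hA one_pos] at hq
        exact ⟨hq.1.le, by linarith [hq.2.1]⟩)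
      (by positivity)
      (by
        have e : (β.re - 2 * δ - (A + 2 * δ)) / δ - 4 = (β.re - A) / δ - 8 := by
          field_simp; ring
        rw [e, le_sub_iff_add_le, le_div_iff₀ hδ]
        have h1 : (n : ℝ) * δ ≤ (n₀ + 1) * δ + β.im := by
          have := mul_le_mul_of_nonneg_right hnle hδ.le
          have e2 : ((n₀ : ℝ) + (β.im / δ + 1)) * δ = (n₀ + 1) * δ + β.im := by
            field_simp; ring
          linarith [e2]
        nlinarith)
      (by rw [sub_zero]; exact hnge)
    calc cornerCrossingProb t R' δ
        = (cornerPercolation t).real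
            (embDomainCrossing squareLatticeEmbedding.z R'.carrier δ (R'.arc 0) (R'.arc 2)) :=
          cornerCrossingProb_eq t R' δ
      _ ≤ (cornerPercolation t).real
            (embRectCrossing (fun v => squareLatticeEmbedding.z v - w) ((1 / 2 : ℝ) * n) n) :=
          cornerPercolation_real_le_of_edgeSet t hw
      _ ≤ 1 - c := hbox n hn₀ w
  have hev : ∀ᶠ δ in 𝓝[>] (0 : ℝ), cornerCrossingProb t R' δ ≤ 1 - c := by
    filter_upwards [Ioc_mem_nhdsGT hδ₀pos] with δ hδ
    exact hbound δ hδ.1 hδ.2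
  have hle : p ≤ 1 - c := le_of_tendsto hlim hev
  linarith

/-- **Left-sheared boxes are not crossed with probability near one** — the mirror statement of
`re_le_of_gateLR` (`re β < -(A + im β / 2)`: the top side lies to the LEFT of the bottom side;
read the crude crossing from the top arc to the bottom arc, `embDomainCrossing_comm`, and apply
`stub_gateLR` to the slab `re β + A + 2δ ≤ re ≤ -2δ`). -/
theorem neg_re_le_of_gateLR (t : unitInterval) {β : ℂ} (hβ : 0 < β.im) {A c p : ℝ} (hA : 0 < A)
    {n₀ : ℕ} (hbox : ∀ n : ℕ, n₀ ≤ n → ∀ w : ℂ, (cornerPercolation t).real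
      (embRectCrossing (fun v => squareLatticeEmbedding.z v - w) ((1 / 2 : ℝ) * n) n) ≤ 1 - c)
    (hp : 1 - c < p)
    (hlim : Tendsto (cornerCrossingProb t ((rectQuad 0 A 0 1 hA one_pos).map
      (shearHomeomorph β hβ.ne'))) (𝓝[>] 0) (𝓝 p)) :
    -(A + β.im / 2) ≤ β.re := by
  by_contra H
  rw [not_le] at H
  set R' := (rectQuad 0 A 0 1 hA one_pos).map (shearHomeomorph β hβ.ne') with hR'
  set ε₀ : ℝ := -β.re - A - β.im / 2 with hε₀
  have hε₀pos : 0 < ε₀ := by rw [hε₀]; linarith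
  set δ₀ : ℝ := 2 * ε₀ / (n₀ + 17) with hδ₀
  have hδ₀pos : 0 < δ₀ := by positivity
  have hbound : ∀ δ : ℝ, 0 < δ → δ ≤ δ₀ → cornerCrossingProb t R' δ ≤ 1 - c := by
    intro δ hδ hδle
    have hδ1 : δ * ((n₀ : ℝ) + 17) ≤ 2 * ε₀ := by
      rwa [hδ₀, le_div_iff₀ (by positivity : (0 : ℝ) < n₀ + 17)] at hδle
    set n : ℕ := max n₀ ⌈β.im / δ⌉₊ with hn
    have hn₀ : n₀ ≤ n := le_max_left _ _
    have hnge : β.im / δ ≤ n := (Nat.le_ceil _).trans (by exact_mod_cast le_max_right _ _)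
    have hnle : (n : ℝ) ≤ n₀ + (β.im / δ + 1) := by
      have h1 : ((⌈β.im / δ⌉₊ : ℕ) : ℝ) < β.im / δ + 1 := Nat.ceil_lt_add_one (by positivity)
      have h2 : (n : ℝ) ≤ max (n₀ : ℝ) ((⌈β.im / δ⌉₊ : ℕ) : ℝ) := by
        rw [hn]; push_cast [Nat.cast_max]; exact le_rfl
      have h3 : max (n₀ : ℝ) ((⌈β.im / δ⌉₊ : ℕ) : ℝ) ≤ n₀ + (β.im / δ + 1) :=
        max_le (by linarith [div_nonneg hβ.le hδ.le]) (by linarith [h1, (Nat.cast_nonneg n₀ : (0:ℝ) ≤ n₀)])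
      linarith
    -- gate for the crossing read from the top arc (left) to the bottom arc (right)
    obtain ⟨w, hw⟩ := stub_gateLR R'.carrier (R'.arc 2) (R'.arc 0) (δ := δ)
      (x₁ := β.re + A + 2 * δ) (x₂ := -(2 * δ)) (y₁ := 0) (y₂ := β.im)
      (a := (1 / 2 : ℝ) * n) (b := n) hδ
      (fun q _ hq => by
        have := (bounds_of_infDist_arc_two_le hβ hA one_pos hq).2.2
        linarith)
      (fun q _ hq => by
        have := (bounds_of_infDist_arc_zero_le hβ hA one_pos hq).2.1
        linarith)
      (fun q hq _ _ => by
        rw [hR', mem_shearedBox_carrier hβ hA one_pos] at hq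
        exact ⟨hq.1.le, by linarith [hq.2.1]⟩)
      (by positivity)
      (by
        have e : (-(2 * δ) - (β.re + A + 2 * δ)) / δ - 4 = (-β.re - A) / δ - 8 := by
          field_simp; ring
        rw [e, le_sub_iff_add_le, le_div_iff₀ hδ]
        have h1 : (n : ℝ) * δ ≤ (n₀ + 1) * δ + β.im := by
          have := mul_le_mul_of_nonneg_right hnle hδ.le
          have e2 : ((n₀ : ℝ) + (β.im / δ + 1)) * δ = (n₀ + 1) * δ + β.im := by
            field_simp; ring
          linarith [e2]
        nlinarith)
      (by rw [sub_zero]; exact hnge)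
    calc cornerCrossingProb t R' δ
        = (cornerPercolation t).real
            (embDomainCrossing squareLatticeEmbedding.z R'.carrier δ (R'.arc 0) (R'.arc 2)) :=
          cornerCrossingProb_eq t R' δ
      _ = (cornerPercolation t).real
            (embDomainCrossing squareLatticeEmbedding.z R'.carrier δ (R'.arc 2) (R'.arc 0)) := by
          rw [embDomainCrossing_comm]
      _ ≤ (cornerPercolation t).real
            (embRectCrossing (fun v => squareLatticeEmbedding.z v - w) ((1 / 2 : ℝ) * n) n) :=
          cornerPercolation_real_le_of_edgeSet t hw
      _ ≤ 1 - c := hbox n hn₀ w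
  have hev : ∀ᶠ δ in 𝓝[>] (0 : ℝ), cornerCrossingProb t R' δ ≤ 1 - c := by
    filter_upwards [Ioc_mem_nhdsGT hδ₀pos] with δ hδ
    exact hbound δ hδ.1 hδ.2
  have hle : p ≤ 1 - c := le_of_tendsto hlim hev
  linarith

/-- **Both sheared cases**: under the hypotheses of `re_le_of_gateLR`, `|re β| ≤ A + im β / 2`. -/
theorem abs_re_le_of_gateLR (t : unitInterval) {β : ℂ} (hβ : 0 < β.im) {A c p : ℝ} (hA : 0 < A) {n₀ : ℕ} (hbox : ∀ n : ℕ, n₀ ≤ n → ∀ w : ℂ, (cornerPercolation t).real (embRectCrossing (fun v => squareLatticeEmbedding.z v - w) ((1 / 2 : ℝ) * n) n) ≤ 1 - c) (hp : 1 - c < p) (hlim : Tendsto (cornerCrossingProb t ((rectQuad 0 A 0 1 hA one_pos).map (shearHomeomorph β hβ.ne'))) (𝓝[>] 0) (𝓝 p)) : |β.re| ≤ A + β.im / 2 :=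
  abs_le.2 ⟨neg_re_le_of_gateLR t hβ hA hbox hp hlim, re_le_of_gateLR t hβ hA hbox hp hlim⟩

end Summit.CriticalPhenomena.CardyFormulaZ2.Cruxes.SegmentClosed.Sketch

end
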